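import Mathlib
import Summits.Ventures.PercRepro2.Defs
import Summits.Ventures.PercRepro2.Harris
import Summits.Ventures.PercRepro2.CoinChain

/-!
# The three-branch algebra of the pendant path (blind cell PercRepro2, night-2;
proofs/NIGHT2-DARC.md §12)

`path_alg`: level masses `π₀, π₁, π₂` (pivotal level `π₂ > 0`), reduced masses `P_j′ > 0` and
`A_j, B_j, C_j` on the chain `R₀ ⊇ R₁ ⊇ R₂ ⊇ R₃`; covariances `≥ 0` on the gate pieces `R₀, R₁, R₃`,
means decreasing along the chain (cleared forms): the cleared gate functional is nonnegative — the
chain lemma `chain_alg` applied to the two non-pivotal branches, plus the divided-form bookkeeping.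
Also `prob_mono_of_subset`. Used by `CoinPath.lean`.
-/

namespace Summit.Ventures.PercRepro2.Coin

section PathTheorem

open Classical

variable {V : Type*} {E : Type*} [DecidableEq V] [Fintype E] [DecidableEq E]
  {R : Type*} [Field R] [LinearOrder R] [IsStrictOrderedRing R]

omit [DecidableEq V] in
/-- Probability is monotone under inclusion. -/
lemma prob_mono_of_subset (p : E → R) (hp : IsProbVec p) {A B : Set (Config E)} (h : A ⊆ B) :
    prob p A ≤ prob p B := by
  rw [prob_eq_expect_indicator, prob_eq_expect_indicator]
  exact expect_mono hp fun ω =>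
    Set.indicator_le_indicator_of_subset h (fun _ => zero_le_one) ω

omit [DecidableEq V] [Fintype E] [DecidableEq E] in
/-- **The three-branch algebra.** Level masses `π₀, π₁, π₂` (the pivotal level `π₂ > 0`), reduced
masses `P_j′ > 0`, `A_j, B_j, C_j` on the chain `R₀ ⊇ R₁ ⊇ R₂ ⊇ R₃`; covariances `≥ 0` on the gate
pieces `R₀, R₁, R₃`, means decreasing along the chain: then the cleared gate functional
`P² C_E − P A B_E − P B A_E + A B P_E` with `P = π₀P₀′ + π₁P₁′ + π₂P₂′`, `A = π₀A₀ + π₁A₁ + π₂A₂`,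
`B = …`, `C_E = π₀C₀ + π₁C₁ + π₂C₃`, `A_E = π₀A₀ + π₁A₁ + π₂A₃`, `B_E = …`, `P_E = π₀P₀′ + π₁P₁′ + π₂P₃′`
is nonnegative (`chain_alg` with the two non-pivotal branches). -/
theorem path_alg {π₀ π₁ π₂ P₀' P₁' P₂' P₃' A₀ A₁ A₂ A₃ B₀ B₁ B₂ B₃ C₀ C₁ C₃ : R}
    (hπ₀ : 0 ≤ π₀) (hπ₁ : 0 ≤ π₁) (hπ₂ : 0 < π₂)
    (hP₀ : 0 < P₀') (hP₁ : 0 < P₁') (hP₂ : 0 < P₂') (hP₃ : 0 < P₃') (hP₃₂ : P₃' ≤ P₂')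
    (hcov₀ : 0 ≤ P₀' * C₀ - A₀ * B₀) (hcov₁ : 0 ≤ P₁' * C₁ - A₁ * B₁)
    (hcov₃ : 0 ≤ P₃' * C₃ - A₃ * B₃)
    (hA₀₁ : A₁ * P₀' ≤ A₀ * P₁') (hA₁₂ : A₂ * P₁' ≤ A₁ * P₂') (hA₂₃ : A₃ * P₂' ≤ A₂ * P₃')
    (hB₀₁ : B₁ * P₀' ≤ B₀ * P₁') (hB₁₂ : B₂ * P₁' ≤ B₁ * P₂') (hB₂₃ : B₃ * P₂' ≤ B₂ * P₃') :
    0 ≤ (π₀ * P₀' + π₁ * P₁' + π₂ * P₂') ^ 2 * (π₀ * C₀ + π₁ * C₁ + π₂ * C₃)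
      - (π₀ * P₀' + π₁ * P₁' + π₂ * P₂') * (π₀ * A₀ + π₁ * A₁ + π₂ * A₂)
          * (π₀ * B₀ + π₁ * B₁ + π₂ * B₃)
      - (π₀ * P₀' + π₁ * P₁' + π₂ * P₂') * (π₀ * B₀ + π₁ * B₁ + π₂ * B₂)
          * (π₀ * A₀ + π₁ * A₁ + π₂ * A₃)
      + (π₀ * A₀ + π₁ * A₁ + π₂ * A₂) * (π₀ * B₀ + π₁ * B₁ + π₂ * B₂)
          * (π₀ * P₀' + π₁ * P₁' + π₂ * P₃') := by
  -- means and weights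
  set W₀ := π₀ * P₀' with hW₀
  set W₁ := π₁ * P₁' with hW₁
  set W₂ := π₂ * P₂' with hW₂
  set x₀ := A₀ / P₀' with hx₀
  set x₁ := A₁ / P₁' with hx₁
  set x₂ := A₂ / P₂' with hx₂
  set x₃ := A₃ / P₃' with hx₃
  set y₀ := B₀ / P₀' with hy₀
  set y₁ := B₁ / P₁' with hy₁
  set y₂ := B₂ / P₂' with hy₂
  set y₃ := B₃ / P₃' with hy₃
  set Ptot := W₀ + W₁ + W₂ with hPtot
  have hPtot0 : 0 < Ptot := by
    have := mul_pos hπ₂ hP₂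
    have := mul_nonneg hπ₀ hP₀.le
    have := mul_nonneg hπ₁ hP₁.le
    simp only [hPtot, hW₀, hW₁, hW₂]; linarith
  set mX := (W₀ * x₀ + W₁ * x₁ + W₂ * x₂) / Ptot with hmX
  set mY := (W₀ * y₀ + W₁ * y₁ + W₂ * y₂) / Ptot with hmY
  have hx₁₀ : x₁ ≤ x₀ := by rw [hx₀, hx₁, div_le_div_iff₀ hP₁ hP₀]; linarith
  have hx₂₁ : x₂ ≤ x₁ := by rw [hx₁, hx₂, div_le_div_iff₀ hP₂ hP₁]; linarith
  have hx₃₂ : x₃ ≤ x₂ := by rw [hx₂, hx₃, div_le_div_iff₀ hP₃ hP₂]; linarith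
  have hy₁₀ : y₁ ≤ y₀ := by rw [hy₀, hy₁, div_le_div_iff₀ hP₁ hP₀]; linarith
  have hy₂₁ : y₂ ≤ y₁ := by rw [hy₁, hy₂, div_le_div_iff₀ hP₂ hP₁]; linarith
  have hy₃₂ : y₃ ≤ y₂ := by rw [hy₂, hy₃, div_le_div_iff₀ hP₃ hP₂]; linarith
  have hsumP : (∑ i ∈ (Finset.univ : Finset (Fin 2)), ![W₀, W₁] i) = W₀ + W₁ := by
    simp [Fin.sum_univ_two]
  have hsumX : (∑ i ∈ (Finset.univ : Finset (Fin 2)), ![W₀, W₁] i * ![x₀, x₁] i)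
      = W₀ * x₀ + W₁ * x₁ := by simp [Fin.sum_univ_two]
  have hsumY : (∑ i ∈ (Finset.univ : Finset (Fin 2)), ![W₀, W₁] i * ![y₀, y₁] i)
      = W₀ * y₀ + W₁ * y₁ := by simp [Fin.sum_univ_two]
  have hsumS : (∑ i ∈ (Finset.univ : Finset (Fin 2)),
      ![W₀, W₁] i * (![x₀, x₁] i - mX) * (![y₀, y₁] i - mY))
      = W₀ * (x₀ - mX) * (y₀ - mY) + W₁ * (x₁ - mX) * (y₁ - mY) := by simp [Fin.sum_univ_two]
  have hPw : ∀ i ∈ (Finset.univ : Finset (Fin 2)), 0 ≤ ![W₀, W₁] i := by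
    simp only [Finset.mem_univ, true_implies, Fin.forall_fin_two, Matrix.cons_val_zero,
      Matrix.cons_val_one]
    exact ⟨by rw [hW₀]; positivity, by rw [hW₁]; positivity⟩
  have hmono : ∀ i ∈ (Finset.univ : Finset (Fin 2)), ∀ j ∈ (Finset.univ : Finset (Fin 2)),
      0 ≤ (![x₀, x₁] i - ![x₀, x₁] j) * (![y₀, y₁] i - ![y₀, y₁] j) := by
    simp only [Finset.mem_univ, true_implies, Fin.forall_fin_two, Matrix.cons_val_zero,
      Matrix.cons_val_one, sub_self, zero_mul, le_refl, true_and, and_true]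
    exact ⟨mul_nonneg (by linarith) (by linarith),
      mul_nonneg_of_nonpos_of_nonpos (by linarith) (by linarith)⟩
  have hxk : ∀ i ∈ (Finset.univ : Finset (Fin 2)), x₂ ≤ ![x₀, x₁] i := by
    simp only [Finset.mem_univ, true_implies, Fin.forall_fin_two, Matrix.cons_val_zero,
      Matrix.cons_val_one]
    exact ⟨by linarith, hx₂₁⟩
  have hyk : ∀ i ∈ (Finset.univ : Finset (Fin 2)), y₂ ≤ ![y₀, y₁] i := by
    simp only [Finset.mem_univ, true_implies, Fin.forall_fin_two, Matrix.cons_val_zero,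
      Matrix.cons_val_one]
    exact ⟨by linarith, hy₂₁⟩
  have hchain := chain_alg (Finset.univ : Finset (Fin 2)) ![W₀, W₁] ![x₀, x₁] ![y₀, y₁] hPw hmono
    W₂ x₂ y₂ (by rw [hW₂]; exact mul_pos hπ₂ hP₂) hxk hyk
    (P₃' / P₂') (div_nonneg hP₃.le hP₂.le) ((div_le_one hP₂).mpr hP₃₂)
    x₃ y₃ hx₃₂ hy₃₂ Ptot mX mY
    (by rw [hsumP])
    (by rw [hsumX, hmX, div_mul_cancel₀ _ hPtot0.ne'])
    (by rw [hsumY, hmY, div_mul_cancel₀ _ hPtot0.ne'])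
  rw [hsumS] at hchain
  -- covariances in divided form
  set cov₀ := C₀ / P₀' - x₀ * y₀ with hcov₀def
  set cov₁ := C₁ / P₁' - x₁ * y₁ with hcov₁def
  set cov₃ := C₃ / P₃' - x₃ * y₃ with hcov₃def
  have hcov₀' : 0 ≤ cov₀ := by
    have e : cov₀ = (P₀' * C₀ - A₀ * B₀) / (P₀' * P₀') := by
      rw [hcov₀def, hx₀, hy₀]; field_simp
    rw [e]; exact div_nonneg hcov₀ (by positivity)
  have hcov₁' : 0 ≤ cov₁ := by
    have e : cov₁ = (P₁' * C₁ - A₁ * B₁) / (P₁' * P₁') := by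
      rw [hcov₁def, hx₁, hy₁]; field_simp
    rw [e]; exact div_nonneg hcov₁ (by positivity)
  have hcov₃' : 0 ≤ cov₃ := by
    have e : cov₃ = (P₃' * C₃ - A₃ * B₃) / (P₃' * P₃') := by
      rw [hcov₃def, hx₃, hy₃]; field_simp
    rw [e]; exact div_nonneg hcov₃ (by positivity)
  -- masses in terms of means
  have eA₀ : A₀ = x₀ * P₀' := by rw [hx₀]; field_simp
  have eA₁ : A₁ = x₁ * P₁' := by rw [hx₁]; field_simp
  have eA₂ : A₂ = x₂ * P₂' := by rw [hx₂]; field_simp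
  have eA₃ : A₃ = x₃ * P₃' := by rw [hx₃]; field_simp
  have eB₀ : B₀ = y₀ * P₀' := by rw [hy₀]; field_simp
  have eB₁ : B₁ = y₁ * P₁' := by rw [hy₁]; field_simp
  have eB₂ : B₂ = y₂ * P₂' := by rw [hy₂]; field_simp
  have eB₃ : B₃ = y₃ * P₃' := by rw [hy₃]; field_simp
  have eC₀ : C₀ = (cov₀ + x₀ * y₀) * P₀' := by rw [hcov₀def]; field_simp; ring
  have eC₁ : C₁ = (cov₁ + x₁ * y₁) * P₁' := by rw [hcov₁def]; field_simp; ring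
  have eC₃ : C₃ = (cov₃ + x₃ * y₃) * P₃' := by rw [hcov₃def]; field_simp; ring
  have eA : π₀ * A₀ + π₁ * A₁ + π₂ * A₂ = mX * Ptot := by
    rw [hmX, div_mul_cancel₀ _ hPtot0.ne', eA₀, eA₁, eA₂, hW₀, hW₁, hW₂]; ring
  have eB : π₀ * B₀ + π₁ * B₁ + π₂ * B₂ = mY * Ptot := by
    rw [hmY, div_mul_cancel₀ _ hPtot0.ne', eB₀, eB₁, eB₂, hW₀, hW₁, hW₂]; ring
  have eW₂ : P₃' / P₂' * W₂ = π₂ * P₃' := by rw [hW₂]; field_simp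
  rw [eW₂] at hchain
  -- the goal is stated in the original masses; `set` has already abbreviated the weights
  have hgoal : (π₀ * P₀' + π₁ * P₁' + π₂ * P₂') ^ 2 * (π₀ * C₀ + π₁ * C₁ + π₂ * C₃)
      - (π₀ * P₀' + π₁ * P₁' + π₂ * P₂') * (π₀ * A₀ + π₁ * A₁ + π₂ * A₂)
          * (π₀ * B₀ + π₁ * B₁ + π₂ * B₃)
      - (π₀ * P₀' + π₁ * P₁' + π₂ * P₂') * (π₀ * B₀ + π₁ * B₁ + π₂ * B₂)
          * (π₀ * A₀ + π₁ * A₁ + π₂ * A₃)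
      + (π₀ * A₀ + π₁ * A₁ + π₂ * A₂) * (π₀ * B₀ + π₁ * B₁ + π₂ * B₂)
          * (π₀ * P₀' + π₁ * P₁' + π₂ * P₃')
      = Ptot ^ 2 * ((W₀ * cov₀ + W₁ * cov₁ + π₂ * P₃' * cov₃)
          + (W₀ * (x₀ - mX) * (y₀ - mY) + W₁ * (x₁ - mX) * (y₁ - mY)
            + π₂ * P₃' * (x₃ - mX) * (y₃ - mY))) := by
    have hPt : π₀ * P₀' + π₁ * P₁' + π₂ * P₂' = Ptot := by rw [hPtot, hW₀, hW₁, hW₂]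
    have eA' : π₀ * A₀ + π₁ * A₁ + π₂ * A₂ = mX * Ptot := eA
    have eB' : π₀ * B₀ + π₁ * B₁ + π₂ * B₂ = mY * Ptot := eB
    rw [hPt, eA', eB', eA₀, eA₁, eA₃, eB₀, eB₁, eB₃, eC₀, eC₁, eC₃, hW₀, hW₁]
    ring
  rw [hgoal]
  refine mul_nonneg (sq_nonneg _) (add_nonneg ?_ hchain)
  have h0 : 0 ≤ W₀ * cov₀ := mul_nonneg (by rw [hW₀]; positivity) hcov₀'
  have h1 : 0 ≤ W₁ * cov₁ := mul_nonneg (by rw [hW₁]; positivity) hcov₁'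
  have h3 : 0 ≤ π₂ * P₃' * cov₃ := mul_nonneg (by positivity) hcov₃'
  linarith

end PathTheorem

end Summit.Ventures.PercRepro2.Coin
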